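import Mathlib
import HarnessLib

/-!
# Richardson (zero-noise) extrapolation: the coefficient equations, their Lagrange solution, and
# exactness on a truncated noise expansion (Temme–Bravyi–Gambetta, PRL 119, 180509)

Topic `Computability/QuantumAlgorithms`.  PUBLISHED RESULT with our proof; one definition (the
printed closed-form coefficients) and NO named fact (`def … : Prop`) (D-0026).  Mathlib ∕ Literature
had no Richardson ∕ zero-noise-extrapolation statement (`lean search 'Richardson'`, `'zeroNoise'`:
nothing); the proof is a thin layer over Mathlib's Lagrange interpolation (`Lagrange.basis`,
`Lagrange.interpolate`, `Lagrange.eq_interpolate`).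

HONEST FRAMING: instance-level adjudication of specific advantage claims; no claim about BQP vs BPP
or the summit.

## Source (read on the materialised text) and what is taken

K. Temme, S. Bravyi, J. M. Gambetta, *Error Mitigation for Short-Depth Quantum Circuits*,
Phys. Rev. Lett. **119**, 180509 (2017) = arXiv:1612.02058 [TemmeBravyiGambetta2017] (held text
`paper:arxiv-1612.02058`, chunks p0003 (main text) and p0009–p0010 (Supplement §I)).  Main text:
"the function `E_K(λ)` can be expressed as a series in `λ` … `E_K(λ) = E* + Σ_{k=1}^{n} a_k λ^k +
R_{n+1}(λ, ℒ, T)` (expansion) … let us assume we can run the quantum circuit at different noise rates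
`λ_j`, with `j = 0, …, n` … `λ_j = c_j λ` … the estimate … `Ê^n_K(λ) = Σ_{j=0}^{n} γ_j Ê_K(c_j λ)`
(RichardsonCoeff). Here we require the coefficients `γ_j` to satisfy the linear system of equations
`Σ_j γ_j = 1` and `Σ_{j=0}^{n} γ_j c_j^k = 0` for `k = 1 … n` (RichardsonEqn) … The equations
(RichardsonEqn) can be solved, and one finds that the coefficients `γ_j = ∏_{m≠j} c_m (c_j − c_m)^{−1}`"
(sic in the held layer — see the remark on the sign below).

## What is formalised (a field `𝕜`, a finite index type `ι` of `n + 1 = |ι|` noise-scale factors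
## `c : ι → 𝕜`, pairwise distinct; `c_0 = 1` is not needed)

* `richardsonCoeff c j = ∏_{m ≠ j} c_m ∕ (c_m − c_j)` (def) — the Lagrange basis polynomials of the
  nodes `c` evaluated at `0` (`richardsonCoeff_eq_eval_basis`);
* **`sum_richardsonCoeff_mul_eval`** — for every polynomial `p` with `deg p < |ι|`:
  `Σ_j γ_j p(c_j) = p(0)`;
* **`sum_richardsonCoeff`**, **`sum_richardsonCoeff_mul_pow`** — these `γ_j` SOLVE the printed system
  (RichardsonEqn): `Σ_j γ_j = 1` and `Σ_j γ_j c_j^k = 0` for `1 ≤ k ≤ n`;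
* **`richardson_estimate_eq_of_truncated`** — exactness of (RichardsonCoeff) on the truncated
  expansion: if `E(λ′) = E* + Σ_{k=1}^{n} a_k λ′^k` (the printed series with `R_{n+1} = 0`) then
  `Σ_j γ_j E(c_j λ) = E*` for every `λ`, for ANY coefficients satisfying (RichardsonEqn)
  (`…_of_richardsonEqn`) and in particular for `richardsonCoeff`.

Remark on the sign of the closed form: with two nodes (`n = 1`) the requirement `Σ_j γ_j = 1` forces
`γ_0 = c_1∕(c_1 − c_0)`, `γ_1 = c_0∕(c_0 − c_1)`, i.e. `γ_j = ∏_{m≠j} c_m (c_m − c_j)^{−1}`; the held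
layer's `(c_j − c_m)^{−1}` differs from this by the factor `(−1)^n`.  We therefore formalise the
printed LINEAR SYSTEM (RichardsonEqn) as the defining requirement and prove that the Lagrange-at-zero
coefficients solve it; nothing below depends on the disputed sign.

NOT formalised: the error bound `|E* − Ê^n_K(λ)| ≤ Γ_n(δ* + ‖A‖ l_{n+1}(λT)^{n+1}∕(n+1)!)` and the
series expansion of `E_K(λ)` itself (Supplement §I: Dyson series, Hölder bounds), the rescaling
protocol (§II), uniqueness of the solution of (RichardsonEqn) (Vandermonde), and the
quasi-probability method of the same Letter.

Context (cell pub-qadeq): zero-noise extrapolation is the mitigation primitive behind many hardware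
rows (the IBM 'utility' records, CLAIMS A-1453's HAEM-vs-ZNE comparison, the digital-ZNE literature);
the register cites this file for "ZNE with `n + 1` scale factors is exact on a degree-`n` noise
polynomial and its coefficients are the Lagrange weights at zero".
-/

noncomputable section

open Finset Polynomial

namespace Literature.Computability.QuantumAlgorithms

namespace ZeroNoiseExtrapolation

variable {𝕜 : Type*} [Field 𝕜] {ι : Type*} [Fintype ι] [DecidableEq ι]

/-- **Richardson coefficients** for pairwise distinct noise-scale factors `c : ι → 𝕜`:
`γ_j = ∏_{m ≠ j} c_m ∕ (c_m − c_j)` — the Lagrange basis polynomials of the nodes `c_j` evaluated at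
the zero-noise point `λ = 0`. [cite: TemmeBravyiGambetta2017, eqs. (RichardsonCoeff)–(RichardsonEqn)
and the closed form after eq. (bound)] -/
def richardsonCoeff (c : ι → 𝕜) (j : ι) : 𝕜 :=
  ∏ m ∈ univ.erase j, c m / (c m - c j)

/-- Unfolding lemma. [cite: TemmeBravyiGambetta2017, eq. (RichardsonCoeff)] -/
theorem richardsonCoeff_def (c : ι → 𝕜) (j : ι) :
    richardsonCoeff c j = ∏ m ∈ univ.erase j, c m / (c m - c j) := rfl

/-- The Richardson coefficient `γ_j` is the `j`-th Lagrange basis polynomial of the nodes `c`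
evaluated at `0`. [cite: TemmeBravyiGambetta2017, eq. (RichardsonEqn) ("can be solved, and one finds
that the coefficients `γ_j = ∏_{m≠j} …`")] -/
theorem richardsonCoeff_eq_eval_basis (c : ι → 𝕜) (j : ι) :
    richardsonCoeff c j = (Lagrange.basis univ c j).eval 0 := by
  rw [richardsonCoeff_def, Lagrange.basis, eval_prod]
  refine prod_congr rfl fun m _ => ?_
  rw [Lagrange.basisDivisor, eval_mul, eval_C, eval_sub, eval_X, eval_C, zero_sub, mul_neg,
    ← neg_mul, ← inv_neg, neg_sub, div_eq_inv_mul]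

/-- **The Richardson combination reproduces the value at zero of every polynomial of degree
`< |ι|`**: `Σ_j γ_j p(c_j) = p(0)` (Lagrange interpolation through the `|ι|` distinct nodes is exact
on such `p`). [cite: TemmeBravyiGambetta2017, eqs. (expansion), (RichardsonCoeff)–(RichardsonEqn)] -/
theorem sum_richardsonCoeff_mul_eval {c : ι → 𝕜} (hc : Function.Injective c) (p : 𝕜[X])
    (hp : p.degree < Fintype.card ι) :
    ∑ j, richardsonCoeff c j * p.eval (c j) = p.eval 0 := by
  have hinterp := Lagrange.eq_interpolate (s := univ) (v := c) hc.injOn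
    (by rwa [Finset.card_univ])
  conv_rhs => rw [hinterp]
  rw [Lagrange.interpolate_apply, eval_finsetSum]
  refine sum_congr rfl fun j _ => ?_
  rw [eval_mul, eval_C, richardsonCoeff_eq_eval_basis, mul_comm]

/-- **(RichardsonEqn), first equation**: `Σ_j γ_j = 1`.
[cite: TemmeBravyiGambetta2017, eq. (RichardsonEqn)] -/
theorem sum_richardsonCoeff [Nonempty ι] {c : ι → 𝕜} (hc : Function.Injective c) :
    ∑ j, richardsonCoeff c j = 1 := by
  have h := sum_richardsonCoeff_mul_eval hc (1 : 𝕜[X])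
    (by rw [degree_one]; exact_mod_cast Fintype.card_pos)
  simpa using h

/-- **(RichardsonEqn), the other `n` equations**: `Σ_j γ_j c_j^k = 0` for `1 ≤ k ≤ n = |ι| − 1` —
the combination "cancels powers of the noise perturbations".
[cite: TemmeBravyiGambetta2017, eq. (RichardsonEqn)] -/
theorem sum_richardsonCoeff_mul_pow {c : ι → 𝕜} (hc : Function.Injective c) {k : ℕ} (hk1 : 1 ≤ k)
    (hk : k < Fintype.card ι) :
    ∑ j, richardsonCoeff c j * c j ^ k = 0 := by
  have h := sum_richardsonCoeff_mul_eval hc (X ^ k : 𝕜[X])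
    (by rw [degree_X_pow]; exact_mod_cast hk)
  have hk0 : k ≠ 0 := by omega
  simpa [eval_pow, eval_X, zero_pow hk0] using h

omit [DecidableEq ι] in
/-- **Exactness of the estimator (RichardsonCoeff) on the truncated expansion, for ANY solution of
(RichardsonEqn)**: if `Σ_j γ_j = 1` and `Σ_j γ_j c_j^k = 0` for `k = 1 … n`, and the noisy
expectation value is the printed series without remainder, `E(λ′) = E* + Σ_{k=1}^{n} a_k λ′^k`, then
`Σ_j γ_j E(c_j λ) = E*` for every base noise rate `λ`.
[cite: TemmeBravyiGambetta2017, eqs. (expansion), (RichardsonCoeff), (RichardsonEqn)] -/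
theorem richardson_estimate_eq_of_richardsonEqn {γ c : ι → 𝕜} {n : ℕ}
    (h0 : ∑ j, γ j = 1) (hk : ∀ k ∈ Icc 1 n, ∑ j, γ j * c j ^ k = 0)
    (Estar : 𝕜) (a : ℕ → 𝕜) (lam : 𝕜) :
    ∑ j, γ j * (Estar + ∑ k ∈ Icc 1 n, a k * (c j * lam) ^ k) = Estar := by
  have hsplit : ∀ j, γ j * (Estar + ∑ k ∈ Icc 1 n, a k * (c j * lam) ^ k) =
      γ j * Estar + ∑ k ∈ Icc 1 n, (a k * lam ^ k) * (γ j * c j ^ k) := by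
    intro j
    rw [mul_add, mul_sum]
    congr 1
    refine sum_congr rfl fun k _ => ?_
    rw [mul_pow]; ring
  simp_rw [hsplit]
  rw [sum_add_distrib, ← sum_mul, h0, one_mul, sum_comm]
  have hvanish : ∑ k ∈ Icc 1 n, ∑ j, (a k * lam ^ k) * (γ j * c j ^ k) = 0 := by
    refine sum_eq_zero fun k hk' => ?_
    rw [← mul_sum, hk k hk', mul_zero]
  rw [hvanish, add_zero]

/-- **Richardson extrapolation with `n + 1` distinct scale factors is exact on a degree-`n` noise
polynomial**: with `γ = richardsonCoeff c` and `E(λ′) = E* + Σ_{k=1}^{n} a_k λ′^k`, `n < |ι|`,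
`Ê^n(λ) = Σ_j γ_j E(c_j λ) = E*` — the zero-noise value is recovered exactly (the printed error bound
then consists of the remainder and sampling terms only).
[cite: TemmeBravyiGambetta2017, eqs. (expansion), (RichardsonCoeff), (RichardsonEqn), (bound)] -/
theorem richardson_estimate_eq_of_truncated {c : ι → 𝕜} (hc : Function.Injective c) {n : ℕ}
    (hn : n < Fintype.card ι) (Estar : 𝕜) (a : ℕ → 𝕜) (lam : 𝕜) :
    ∑ j, richardsonCoeff c j * (Estar + ∑ k ∈ Icc 1 n, a k * (c j * lam) ^ k) = Estar := by
  haveI : Nonempty ι := Fintype.card_pos_iff.1 (by omega)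
  refine richardson_estimate_eq_of_richardsonEqn (sum_richardsonCoeff hc) ?_ Estar a lam
  intro k hk
  rw [mem_Icc] at hk
  exact sum_richardsonCoeff_mul_pow hc hk.1 (by omega)

end ZeroNoiseExtrapolation

end Literature.Computability.QuantumAlgorithms

end
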